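import Literature.AlgebraicGeometry.Frobenioids.PadicKummerThm24iFrobenioid
import Literature.AlgebraicGeometry.Frobenioids.PadicKummerContextConj
import HarnessLib

/-!
# Frobenioids II, §2 (Thm. 2.4 (i) final clause, Rmk. 2.4.1): instance-form closers at the `p`-adic
# Frobenioids of §2 themselves (proof-only)

S. Mochizuki, *The geometry of Frobenioids II: poly-Frobenioids*, Kyushu J. Math. **62** (2008) 401–460, §2,
Theorem 2.4 (i) (kurims pp. 19–20) and Remark 2.4.1 (kurims p. 22) [cite: MochizukiFrdII2008, Thm 2.4 (i) p.20]
[cite: MochizukiFrdII2008, Rmk 2.4.1 p.22].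

PROOF-ONLY closer file (abc-iut cell, D-0079 L-F sub-cell [FrdI/II], pack E, seat abc-iut-L1-d9 gen 5; LF-FRD
rows **F-1194** `PadicKummer.Thm24iActionCompat` and **F-1193** `PadicKummer.Rmk241Indeterminacy`, statement
file `PadicKummerActions.lean`, seat abc-iut-L1-d4). Both declarations are SCHEMAS over ARBITRARY comparison data
`T : Thm24Data X₁ X₂ N` between ARBITRARY interface contexts; their universal closures are kernel-false
(abc-iut-f-048's `not_forall_thm24iActionCompat`, `not_forall_rmk241Indeterminacy`, p432861), and the positive
instance of record is abc-iut-L1-d4's `Def22Context.Iso.thm24iActionCompat` / `Iso.rmk241Indeterminacy` (p409386)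
for the data `e.thm24Data N` induced by an isomorphism `e` of contexts. This file states them, with the FACT
declaration as conclusion head and NO new definition, AT THE GENUINE CARRIER of print: the Definition 2.2
contexts `contextOfObject` (seat abc-iut-L1-t7, file D3b) OF THE OBJECTS `A₁`, `Ψ A₁` of two `pᵢ`-adic Frobenioids
`Cᵢ = dᵢ.frobenioid` over the bases `B(G_{ℚ_{pᵢ}})⁰ → D₀` of §2, and the comparison data of the context
isomorphism `isoOfFunctorCoset` INDUCED BY a fully faithful functor `Ψ : C₁ ⥤ C₂` (the equivalence of print;
seat abc-iut-L1-t7, capstone D5 p428662), under the printed inputs BY NAME exactly as in abc-iut-L1-t7's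
`thm24i_ofFunctor`: (hO) "`Ψ` preserves `O^⊳(−)`" ([FrdI] Cor. 4.10/4.11), (isoG, houter, map_H) "the outer
isomorphism `G₁ ⥲ G₂` over which `Ψ_Base` lies, mapping `H₁` onto `H₂`" (Thm. 2.4 setting), `(A₁)_D`, `(Ψ A₁)_D`
Galois:
* `thm24iActionCompat_holds` — Thm. 2.4 (i), final clause: the isomorphisms induced by `Ψ` on `O^□`, `H_A`,
  `H¹(H_A, μ_N(A))`, `F_N(A)` are "compatible … with the various natural actions of `(G₁)_{A₁}/(H₁)_{A₁}`,
  `(G₂)_{A₂}/(H₂)_{A₂}`";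
* `rmk241Indeterminacy_holds` — Rmk. 2.4.1, finite-level content: the data induced by `Ψ` at two levels `N`, `N'`
  agree up to the `(G₂)_{A₂}/(H₂)_{A₂}`-indeterminacy; `rmk241Indeterminacy_holds_conj` — the same when the
  level-`N'` datum is induced by `Ψ` followed by the natural action of any `g₂ ∈ G₂ = G_{ℚ_{p₂}}` (a different
  representative of the outer isomorphism; the lift of `g₂` to `Aut_{C₂}(Ψ A₁)` exists by `Aut`-ampleness,
  abc-iut-L1-t7's `resAut_surjective`), abc-iut-L1-d4's `Iso.rmk241Indeterminacy_conj` (p410079).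
The profinite LIMIT over `N` of Rmk. 2.4.1 is not constructed in the tree (named deferral of the statement file;
not claimed here). Honest framing: FACT rows are assumption LABELS on OUR typed statements of the refereed
[FrdII]; "holds" = OUR kernel check of OUR typed instance form; nothing here bears on [IUTchIII] Cor. 3.12;
typed ≠ proved elsewhere. No definition, no restated schema.
-/

noncomputable section

namespace Literature.AlgebraicGeometry.Frobenioids

namespace PadicKummer.Def22Context

open CategoryTheory Field IntermediateField Kummer Function
open Literature.NumberTheory.GaloisRepresentations
open Literature.AnabelianGeometry.SemiGraphs QuasiTemperoid PadicFrd PadicFrd.Datum PadicFrd.Datum.GaloisChart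

variable {p₁ p₂ : ℕ} [Fact p₁.Prime] [Fact p₂.Prime]
  {d₁ : PadicFrd.Datum (CosetCat (GalFbar ℚ_[p₁])) p₁} (hd₁ : d₁.base = galoisCosetBase p₁)
  {d₂ : PadicFrd.Datum (CosetCat (GalFbar ℚ_[p₂])) p₂} (hd₂ : d₂.base = galoisCosetBase p₂)
  (F : d₁.frobenioid ⥤ d₂.frobenioid) [F.Full] [F.Faithful] {A₁ : d₁.frobenioid}
  (hA₁ : A₁.base.sg.toSubgroup.Normal) (hA₂ : (F.obj A₁).base.sg.toSubgroup.Normal)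
  (hO : ∀ f : A₁ ⟶ A₁, f ∈ PreFrobenioid.endSubmonoid d₁.structureFunctor A₁ ↔
    F.map f ∈ PreFrobenioid.endSubmonoid d₂.structureFunctor (F.obj A₁))
  {H₁ : Subgroup (absoluteGaloisGroup ℚ_[p₁])} [H₁.Normal] {hH₁ : IsOpen (H₁ : Set (absoluteGaloisGroup ℚ_[p₁]))}
  {H₂ : Subgroup (absoluteGaloisGroup ℚ_[p₂])} [H₂.Normal] {hH₂ : IsOpen (H₂ : Set (absoluteGaloisGroup ℚ_[p₂]))}
  (isoG : absoluteGaloisGroup ℚ_[p₁] ≃ₜ* absoluteGaloisGroup ℚ_[p₂])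
  (houter : haveI := normal_objField d₁ A₁ hA₁; haveI := normal_objField d₂ (F.obj A₁) hA₂
    ∀ g : absoluteGaloisGroup ℚ_[p₁], resGal (objField d₂ (F.obj A₁)) (isoG g) =
      galEquiv F (galoisChartCoset d₁ hd₁ A₁) (galoisChartCoset d₂ hd₂ (F.obj A₁)) hO
        (resAut_eq_one_iff d₁ A₁) (resAut_eq_one_iff d₂ (F.obj A₁)) (resGal (objField d₁ A₁) g))
  (map_H : H₁.map isoG.toMulEquiv.toMonoidHom = H₂)

/-! ### F-1194 `Thm24iActionCompat` at the data induced by `Ψ` -/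

/-- **F-1194, instance form AT THE GENUINE CARRIER**: [FrdII] Thm. 2.4 (i), final clause — the isomorphisms
`O^□(A₁) ⥲ O^□(A₂)`, `(H₁)_{A₁} ⥲ (H₂)_{A₂}`, `H¹((H₁)_{A₁}, μ_N(A₁)) ⥲ H¹((H₂)_{A₂}, μ_N(A₂))`,
`F_N(A₁) ⥲ F_N(A₂)` induced by `Ψ` are "compatible … with the various natural actions of `(G₁)_{A₁}/(H₁)_{A₁}`,
`(G₂)_{A₂}/(H₂)_{A₂}`" — HOLDS for the Definition 2.2 contexts OF THE OBJECTS `A₁`, `Ψ A₁` of two `pᵢ`-adic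
Frobenioids over the bases of §2 and the comparison data of the context isomorphism induced by the fully faithful
functor `Ψ` (`isoOfFunctorCoset`), for every level `N` — abc-iut-L1-d4's `Iso.thm24iActionCompat` at that
isomorphism. [cite: MochizukiFrdII2008, Thm 2.4 (i) p.20] -/
theorem thm24iActionCompat_holds (N : ℕ) :
    Literature.AlgebraicGeometry.Frobenioids.PadicKummer.Thm24iActionCompat
      (contextOfObject d₁ hd₁ A₁ hA₁ H₁ hH₁) (contextOfObject d₂ hd₂ (F.obj A₁) hA₂ H₂ hH₂) N
      ((isoOfFunctorCoset hd₁ hd₂ F hA₁ hA₂ hO isoG houter map_H).thm24Data N) :=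
  (isoOfFunctorCoset hd₁ hd₂ F hA₁ hA₂ hO isoG houter map_H).thm24iActionCompat N

/-! ### F-1193 `Rmk241Indeterminacy` at the data induced by `Ψ` at two levels -/

/-- **F-1193, instance form AT THE GENUINE CARRIER, same representative**: [FrdII] Rmk. 2.4.1, finite-level
content — the comparison data induced by `Ψ` at two levels `N`, `N'` (contexts of the objects `A₁`, `Ψ A₁` over
the bases of §2) agree on `O^□` and on `(H₁)_{A₁}` up to the action of an element of `G₂` (here `1`): the typed
`(G₂)_{A₂}/(H₂)_{A₂}`-indeterminacy predicate holds — abc-iut-L1-d4's `Iso.rmk241Indeterminacy`.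
[cite: MochizukiFrdII2008, Rmk 2.4.1 p.22] -/
theorem rmk241Indeterminacy_holds (N N' : ℕ) :
    Literature.AlgebraicGeometry.Frobenioids.PadicKummer.Rmk241Indeterminacy
      (contextOfObject d₁ hd₁ A₁ hA₁ H₁ hH₁) (contextOfObject d₂ hd₂ (F.obj A₁) hA₂ H₂ hH₂)
      ((isoOfFunctorCoset hd₁ hd₂ F hA₁ hA₂ hO isoG houter map_H).thm24Data N)
      ((isoOfFunctorCoset hd₁ hd₂ F hA₁ hA₂ hO isoG houter map_H).thm24Data N') :=
  (isoOfFunctorCoset hd₁ hd₂ F hA₁ hA₂ hO isoG houter map_H).rmk241Indeterminacy N N'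

/-- **F-1193, instance form AT THE GENUINE CARRIER, two representatives**: [FrdII] Rmk. 2.4.1 — "so long as one
allows for a `(Gᵢ)_{Aᵢ}/(Hᵢ)_{Aᵢ}`-indeterminacy": the level-`N` data induced by `Ψ` and the level-`N'` data
induced by `Ψ` followed by the natural action of `g₂ ∈ G₂ = G_{ℚ_{p₂}}` on the context of `Ψ A₁` (through any
lift `α₂ ∈ Aut_{C₂}(Ψ A₁)` of the image of `g₂` in `Gal(K_{Ψ A₁}/ℚ_{p₂})`; such lifts exist by `Aut`-ampleness,
`resAut_surjective`) differ exactly by that indeterminacy — abc-iut-L1-d4's `Iso.rmk241Indeterminacy_conj`.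
[cite: MochizukiFrdII2008, Rmk 2.4.1 p.22] -/
theorem rmk241Indeterminacy_holds_conj (N N' : ℕ) (g₂ : absoluteGaloisGroup ℚ_[p₂]) (α₂ : Aut (F.obj A₁))
    (hα₂ : (contextOfObject d₂ hd₂ (F.obj A₁) hA₂ H₂ hH₂).res α₂ =
      (contextOfObject d₂ hd₂ (F.obj A₁) hA₂ H₂ hH₂).outer g₂) :
    Literature.AlgebraicGeometry.Frobenioids.PadicKummer.Rmk241Indeterminacy
      (contextOfObject d₁ hd₁ A₁ hA₁ H₁ hH₁) (contextOfObject d₂ hd₂ (F.obj A₁) hA₂ H₂ hH₂)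
      ((isoOfFunctorCoset hd₁ hd₂ F hA₁ hA₂ hO isoG houter map_H).thm24Data N)
      (((isoOfFunctorCoset hd₁ hd₂ F hA₁ hA₂ hO isoG houter map_H).trans
        (Iso.conj (contextOfObject d₂ hd₂ (F.obj A₁) hA₂ H₂ hH₂) g₂ α₂ hα₂)).thm24Data N') :=
  (isoOfFunctorCoset hd₁ hd₂ F hA₁ hA₂ hO isoG houter map_H).rmk241Indeterminacy_conj g₂ α₂ hα₂ N N'

omit [F.Full] [F.Faithful] in
/-- The lift hypothesis of `rmk241Indeterminacy_holds_conj` is always satisfiable: every `g₂ ∈ G_{ℚ_{p₂}}` lifts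
to an automorphism of `Ψ A₁` in `C₂` (`Aut`-ampleness of the `p`-adic Frobenioid, abc-iut-L1-t7's
`resAut_surjective`). [cite: MochizukiFrdII2008, Def 2.2 (i) p.17] -/
theorem exists_lift_outer (g₂ : absoluteGaloisGroup ℚ_[p₂]) :
    ∃ α₂ : Aut (F.obj A₁), (contextOfObject d₂ hd₂ (F.obj A₁) hA₂ H₂ hH₂).res α₂ =
      (contextOfObject d₂ hd₂ (F.obj A₁) hA₂ H₂ hH₂).outer g₂ :=
  haveI := finiteDimensional_objField d₂ (F.obj A₁)
  haveI := normal_objField d₂ (F.obj A₁) hA₂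
  resAut_surjective d₂ (F.obj A₁) (resGal (objField d₂ (F.obj A₁)) g₂)

/-- **F-1194 for the conjugated representative as well**: the data induced by `Ψ` followed by the natural action
of `g₂ ∈ G₂` are again compatible with the `(Gᵢ)_{Aᵢ}/(Hᵢ)_{Aᵢ}`-actions (abc-iut-L1-d4's
`Iso.thm24iActionCompat_conj`). [cite: MochizukiFrdII2008, Thm 2.4 (i) p.20] -/
theorem thm24iActionCompat_holds_conj (N : ℕ) (g₂ : absoluteGaloisGroup ℚ_[p₂]) (α₂ : Aut (F.obj A₁))
    (hα₂ : (contextOfObject d₂ hd₂ (F.obj A₁) hA₂ H₂ hH₂).res α₂ =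
      (contextOfObject d₂ hd₂ (F.obj A₁) hA₂ H₂ hH₂).outer g₂) :
    Literature.AlgebraicGeometry.Frobenioids.PadicKummer.Thm24iActionCompat
      (contextOfObject d₁ hd₁ A₁ hA₁ H₁ hH₁) (contextOfObject d₂ hd₂ (F.obj A₁) hA₂ H₂ hH₂) N
      (((isoOfFunctorCoset hd₁ hd₂ F hA₁ hA₂ hO isoG houter map_H).trans
        (Iso.conj (contextOfObject d₂ hd₂ (F.obj A₁) hA₂ H₂ hH₂) g₂ α₂ hα₂)).thm24Data N) :=
  (isoOfFunctorCoset hd₁ hd₂ F hA₁ hA₂ hO isoG houter map_H).thm24iActionCompat_conj g₂ α₂ hα₂ N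

end PadicKummer.Def22Context

end Literature.AlgebraicGeometry.Frobenioids

end
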